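import Summits.ResolutionOfSingularities.ResolutionOfSingularities.Theses.Valuative
import Mathlib.RingTheory.Jacobson.Ring
import Mathlib.RingTheory.Algebraic.Basic
import Mathlib.RingTheory.EssentialFiniteness
import Mathlib.FieldTheory.IntermediateField.Adjoin.Basic

/-!
# Negative lemma for crux `PatchingRel` (stmt-ResolutionOfSingularities-0642): the antecedent
# `LUrel_p` with finite generation of the prescribed algebra `R` dropped is FALSE

Load-bearing analysis (cdisprove gen 4, (H9) of `Cruxes/PatchingRel/Disproof.lean`): the
antecedent of `Valuative.PatchingRel` asks that every FINITELY GENERATED `k`-subalgebra `R ⊆ O`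
of a finitely generated `K/k` be dominated by a finitely generated `A ⊆ O`, `R ≤ A`, regular at the
centre of `O`. Dropping "`R` finitely generated" makes the antecedent false in every prime
characteristic (so the crux with that antecedent would be vacuously true — a trap, like dropping
finite generation of `K/k`, tree `not_lurel_without_fg`): at the trivial valuation `O = K` of
`K = 𝔽_p(X)` take `R = K`; any finitely generated `A ⊇ R` is `K`, so `K` would be a finitely
generated `𝔽_p`-algebra, hence finite over `𝔽_p` by Zariski's lemma
(`finite_of_finite_type_of_isJacobsonRing`), contradicting the transcendence of `X`.
-/

set_option linter.dupNamespace false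

namespace Summit.ResolutionOfSingularities.ResolutionOfSingularities.Theorems.PatchingRel.Negative

/-- **`R.FG` is load-bearing in the antecedent of `PatchingRel`**: relative local uniformization
demanded for ALL `k`-subalgebras `R ⊆ O` (not only the finitely generated ones) fails in every
prime characteristic `p` — witness `k = 𝔽_p`, `K = 𝔽_p(X)`, `O = K`, `R = K`. [folklore] -/
theorem not_lurel_without_rfg (p : ℕ) (hp : p.Prime) :
    ¬ ∀ (k K : Type) [Field k] [CharP k p] [Field K] [Algebra k K],
      (⊤ : IntermediateField k K).FG → ∀ O : ValuationSubring K,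
        (∀ c : k, algebraMap k K c ∈ O) → ∀ R : Subalgebra k K, R.toSubring ≤ O.toSubring →
          ∃ (A : Subalgebra k K) (h : A.toSubring ≤ O.toSubring), R ≤ A ∧ A.FG ∧
            IsFractionRing A K ∧ IsRegularLocalRing (Localization.AtPrime
              (Ideal.comap (Subring.inclusion h) (IsLocalRing.maximalIdeal O))) := by
  intro h
  haveI : Fact p.Prime := ⟨hp⟩
  obtain ⟨A, -, hle, hAfg, -, -⟩ := h (ZMod p) (FractionRing (Polynomial (ZMod p)))
    (IntermediateField.fg_top_iff.mpr
      (Algebra.EssFiniteType.comp (ZMod p) (Polynomial (ZMod p)) _))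
    ⊤ (fun _ => ValuationSubring.mem_top _) ⊤ (fun _ _ => ValuationSubring.mem_top _)
  have htop : (⊤ : Subalgebra (ZMod p) (FractionRing (Polynomial (ZMod p)))).FG := by
    rwa [← eq_top_iff.mpr hle]
  haveI : Algebra.FiniteType (ZMod p) (FractionRing (Polynomial (ZMod p))) := ⟨htop⟩
  haveI : Module.Finite (ZMod p) (FractionRing (Polynomial (ZMod p))) :=
    finite_of_finite_type_of_isJacobsonRing (ZMod p) _
  have hT : Transcendental (ZMod p)
      (algebraMap (Polynomial (ZMod p)) (FractionRing (Polynomial (ZMod p))) Polynomial.X) :=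
    (transcendental_algebraMap_iff (IsFractionRing.injective (Polynomial (ZMod p)) _)).mpr
      (Polynomial.transcendental_X (ZMod p))
  exact hT (Algebra.IsAlgebraic.isAlgebraic _)

/-- Hence the crux with that weakened antecedent holds VACUOUSLY (it proves nothing about
resolution): the implication `(LUrel without R.FG)_p → ResolutionInChar p` for every prime `p`.
[folklore] -/
theorem patchingRel_without_rfg_vacuous (p : ℕ) (hp : p.Prime)
    (h : ∀ (k K : Type) [Field k] [CharP k p] [Field K] [Algebra k K],
      (⊤ : IntermediateField k K).FG → ∀ O : ValuationSubring K,
        (∀ c : k, algebraMap k K c ∈ O) → ∀ R : Subalgebra k K, R.toSubring ≤ O.toSubring →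
          ∃ (A : Subalgebra k K) (h : A.toSubring ≤ O.toSubring), R ≤ A ∧ A.FG ∧
            IsFractionRing A K ∧ IsRegularLocalRing (Localization.AtPrime
              (Ideal.comap (Subring.inclusion h) (IsLocalRing.maximalIdeal O)))) :
    Literature.AlgebraicGeometry.Resolution.ResolutionInChar.{0} p :=
  absurd h (not_lurel_without_rfg p hp)

end Summit.ResolutionOfSingularities.ResolutionOfSingularities.Theorems.PatchingRel.Negative
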